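import Summits.NavierStokesRegularity.NavierStokesRegularity.Theorems.AxisTwistDoorAveragedConeLiouvilleNUFactOfAtomsLip
import Summits.NavierStokesRegularity.NavierStokesRegularity.Theorems.AxisTwistDoorAveragedConeLiouvilleNUMoserIterationGen
import Summits.NavierStokesRegularity.NavierStokesRegularity.Theorems.AxisTwistDoorAveragedConeLiouvilleNUMoserStepLip
import Summits.NavierStokesRegularity.NavierStokesRegularity.Theorems.AxisTwistDoorAveragedConeLiouvilleNUDensityAtomLip
import Summits.NavierStokesRegularity.NavierStokesRegularity.Theorems.AxisTwistDoorAveragedConeLiouvilleNUShrinkingLip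
import Summits.NavierStokesRegularity.NavierStokesRegularity.Theorems.AxisTwistDoorAveragedConeLiouvilleNUStandingOfWeak
import Summits.NavierStokesRegularity.NavierStokesRegularity.Theorems.AxisTwistDoorAveragedConeLiouvilleNUWeakEnergyW1
import Literature.Analysis.FluidPDE.DivFreeDriftPositivityPropagation
import HarnessLib

/-!
# N4 / T1 CLOSER: the typed Literature fact `NazarovUraltseva2011_positivity_propagation` on `ℝ³`
# (positivity propagation for LIPSCHITZ generalized supersolutions of `∂ₜV − ΔV + b·∇V ≥ 0`,
# `b` measurable bounded and divergence free in `𝒟′`) by the axis-free De Giorgi chain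

Route `AxisTwistDoor`, crux `AveragedConeLiouville` (stmt-NavierStokesRegularity-26889, CLOSED `proved`
2026-08-28T14:00Z by the in-tree N3 route; this file discharges the BANKED INPUT of row A12), cell
pub/ns-inputs, programme `kits/N4-T1-skeleton.lean` (ns-in-ser-b g2, 118454bf17607d1e): the composition
`nazarovUraltseva2011_positivity_propagation_of_stubs` of the kit with every stub a theorem of the tree —
M1ᴸ `NU.nuLip_moserStep` (ns-s29-p2 g4, `…NUMoserStepLip`), (B) `NU.nuLip_smallSublevel_lowerBound_of_moserStep`
p639909 (ns-in-ser-a g3), L32ᴸ `NU.nuLip_densityPropagation` p639329 (ns-in-ser-a g3), L33ᴸ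
`NU.nuLip_shrinking` p639446 (ns-qj-p1 g3), W1 `NUPositivity.nu_weakEnergyIdentity` p640099 (ns-in-ser-b g2),
W `NUPositivity.nu_standing_of_weak` p642883 (= `nu_standing_of_weak_of_identity nu_weakEnergyIdentity`;
ns-in-ser-c g2 with (c)/(c2) frames by ns-in-ser-a g3 and W0 by ns-in-ser-b g2), CHAINᴸ
`NUPositivity.nu_fact_of_atoms` p640717 (ns-qj-p1 g3) — over the tree texts `…NULipDefs` p638908 /
`…NUWeakDefs` p639785. This file DISCHARGES THE NAMED FACT `NazarovUraltseva2011_positivity_propagation` at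
`E = ℝ³` (TABLE A row A12 of NS-INPUTS); it lives under Theorems because Literature may not import Summits.

WHAT THIS IS NOT: not a statement about Navier–Stokes regularity; it re-proves a PRINTED theorem
(Nazarov–Uraltseva 2011, §3; Lei–Ren–Tian 2025, Lemma 2.5) inside the tree for `E = ℝ³`; the summit stays
open. [cite: NazarovUraltseva2011HarnackDivFree, §3 (arXiv:1011.1888 pp. 8–10)] [cite: LeiRenTian2025, Lemma 2.5]
-/

noncomputable section

-- the summit and its single sub-problem share the name (CONVENTIONS §1)
set_option linter.dupNamespace false

open Literature.Analysis.FluidPDE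

namespace Summit.NavierStokesRegularity.NavierStokesRegularity.Theorems.AveragedConeLiouville.NUPositivity

/-- **T1: `NazarovUraltseva2011_positivity_propagation (ℝ³)`** — the typed fact, by the Lipschitz De
Giorgi chain (module docstring). [cite: NazarovUraltseva2011HarnackDivFree, §3 (arXiv:1011.1888 pp. 8–10)] -/
theorem nazarovUraltseva2011_positivity_propagation_R3 :
    NazarovUraltseva2011_positivity_propagation (EuclideanSpace ℝ (Fin 3)) :=
  nu_fact_of_atoms (NU.nuLip_smallSublevel_lowerBound_of_moserStep NU.nuLip_moserStep)
    NU.nuLip_densityPropagation NU.nuLip_shrinking nu_standing_of_weak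

/-- Alias under the kit's closer name (registered stub of 26889 for the T1 input). -/
theorem fact_nazarovUraltseva2011 :
    NazarovUraltseva2011_positivity_propagation (EuclideanSpace ℝ (Fin 3)) :=
  nazarovUraltseva2011_positivity_propagation_R3

end Summit.NavierStokesRegularity.NavierStokesRegularity.Theorems.AveragedConeLiouville.NUPositivity

end
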